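import Mathlib
import HarnessLib
import Literature.NumberTheory.Transcendental.LindemannWeierstrassProofs
import Summits.Schanuel.Schanuel.Theses.DiophantineDichotomy
import Summits.Schanuel.Schanuel.Theorems.DiophantineDichotomyApproximationRace

/-!
# Route `DiophantineDichotomy` — the eventual exponent race `ApproximationRaceEv` (stmt-Schanuel-14973)

`Summit.Schanuel.Schanuel.Theses.DiophantineDichotomy.ApproximationRaceEv` is the support item
`ApproximationProperty → KhovanskiiApproxTypeEv → KhovanskiiSchanuel` of route `DiophantineDichotomy`
(the glue of the route's deciding theorem `closes`): Philippon's approximation property in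
transcendence degree `t` (crux `ApproximationProperty`) and an EVENTUAL-in-the-height measure of
simultaneous algebraic approximation with degree exponent `a < 1/(n−1)` at every free Khovanskii
point `θ = (s, e^s) ∈ ℂ²ⁿ` (crux `KhovanskiiApproxTypeEv`: for every degree budget `d` the lower
bound `‖γ − θ‖ ≥ exp(−C(dᵃ log H + dᵇ))` is only asked for heights `H ≥ H₀(d)`) together give
`trdeg_ℚ ℚ(s, e^s) ≥ n` at every such point (target `KhovanskiiSchanuel`).

Proof ("race compactness": FIX the scale `Δ`, let `Y → ∞`; Cruxes/KhovanskiiApproxType/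
IdeatorK2Notes.md §A, re-derived in TRIAGE-r1-2/3):
* `n = 0`: trivial; `n = 1`: Hermite–Lindemann (as in `approximationRace_proof`);
* `n ≥ 2`: if `trdeg < n` then `trdeg ≤ t := n − 1`; the approximation property at `θ = (s, e^s)`
  gives `c ≥ 1`; the eventual measure gives `a < 1/t`, `b`, `C > 0` and thresholds `H₀ : ℕ → ℕ`.
  THE RACE AT FIXED `Δ` (`ApproximationRaceEv.race`, elementary real analysis): there are `Δ ≥ c`
  and `Y₁ ≥ Δ` such that for EVERY `Y ≥ Y₁` no `d ≥ 1`, `H ≥ 1` with `d ≤ (cΔ)^t` satisfies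
  `Δ log H + dY ≤ cC(dᵃ log H + dᵇ)` (choose `Δ^{1−tA} ≥ cC·c^{tA}` with `A = max a 0`, then
  `Y₁ = max Δ (cC(cΔ)^{tB} + 1)` with `B = max b 0`).
  LOW HEIGHTS CANNOT PERSIST (`ApproximationRaceEv.finite_roots`): with `D₀ := ⌊(cΔ)^t⌋₊` and
  `H⋆ := max_{d ≤ D₀} H₀(d)`, the set `F` of points of `ℂ^{2n}` all of whose coordinates are roots
  of non-zero integer polynomials of degree `≤ D₀` and naive height `≤ H⋆` is FINITE (finitely many
  such polynomials, each with finitely many roots), and `θ ∉ F` because `θ` has a transcendental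
  coordinate (`s 0 ≠ 0` by linear independence; if `s 0` is algebraic then `e^{s 0}` is
  transcendental — Hermite–Lindemann, `transcendental_exp_holds`); so some ball `B(θ, ε)` misses
  `F`. Now take `Y ≥ Y₁` with `exp(−Y/c) < ε`: the approximant `(γ, d, H)` at scale `(Δ, Y)` has
  `1 ≤ d ≤ D₀`, `1 ≤ H` and `‖γ − θ‖ ≤ exp(−(Δ log H + dY)/c) ≤ exp(−Y/c) < ε`, so `γ ∉ F`, whence
  `H > H⋆ ≥ H₀(d)`; the eventual measure now applies at `(d, H)` and gives
  `Δ log H + dY ≤ cC(dᵃ log H + dᵇ)` — contradicting the race.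

No new definitions; the only non-Mathlib input is Hermite–Lindemann (proved in the tree), and the
elementary lemmas of `Theorems/DiophantineDichotomyApproximationRace.lean` are reused.
-/

-- `Summit.Schanuel.Schanuel.…` is the mandated summit/sub-problem namespace (single-conjunct summit), hence:
set_option linter.dupNamespace false

namespace Summit.Schanuel.Schanuel.Theorems

open Summit.Schanuel.Schanuel.Theses.DiophantineDichotomy

/-! ## Elementary lemmas -/

/-- THE RACE AT A FIXED SCALE (pure real analysis).  For `t ≥ 1`, `c ≥ 1`, `C > 0` and a degree
exponent `a < 1/t` there is ONE scale `Δ ≥ c` and a threshold `Y₁ ≥ Δ` such that for EVERY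
`Y ≥ Y₁` no `d ≥ 1`, `H ≥ 1` with `d ≤ (cΔ)^t` can satisfy `Δ·log H + d·Y ≤ cC(dᵃ log H + dᵇ)`.
[folklore] -/
theorem ApproximationRaceEv.race {t : ℕ} (ht : 1 ≤ t) {c C a b : ℝ} (hc : 1 ≤ c) (hC : 0 < C)
    (ha : a < 1 / (t : ℝ)) :
    ∃ Δ Y₁ : ℝ, c ≤ Δ ∧ Δ ≤ Y₁ ∧ ∀ Y : ℝ, Y₁ ≤ Y → ∀ d H : ℕ, 1 ≤ d → 1 ≤ H →
      (d : ℝ) ≤ (c * Δ) ^ t →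
        c * (C * ((d : ℝ) ^ a * Real.log H + (d : ℝ) ^ b)) < Real.log H * Δ + d * Y := by
  set A : ℝ := max a 0 with hA
  set B : ℝ := max b 0 with hB
  have htpos : (0 : ℝ) < t := by exact_mod_cast ht
  have hA0 : 0 ≤ A := le_max_right _ _
  have hB0 : 0 ≤ B := le_max_right _ _
  have hAt : (t : ℝ) * A < 1 := by
    have hA' : A < 1 / (t : ℝ) := max_lt ha (by positivity)
    calc (t : ℝ) * A < t * (1 / t) := mul_lt_mul_of_pos_left hA' htpos
      _ = 1 := mul_one_div_cancel htpos.ne'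
  set e : ℝ := 1 - t * A with he
  have hepos : 0 < e := by rw [he]; linarith
  have hcpos : 0 < c := lt_of_lt_of_le one_pos hc
  set M : ℝ := c * C * c ^ ((t : ℝ) * A) with hM
  -- choose `Δ ≥ c` with `Δ ^ e ≥ M`
  have hev : ∀ᶠ Δ in Filter.atTop, c ≤ Δ ∧ M ≤ Δ ^ e :=
    (Filter.eventually_ge_atTop c).and ((tendsto_rpow_atTop hepos).eventually_ge_atTop M)
  obtain ⟨Δ, hcΔ, hMΔ⟩ := hev.exists
  have hΔpos : 0 < Δ := lt_of_lt_of_le hcpos hcΔ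
  have hcΔpos : 0 < c * Δ := mul_pos hcpos hΔpos
  set Y₁ : ℝ := max Δ (c * C * (c * Δ) ^ ((t : ℝ) * B) + 1) with hY₁
  refine ⟨Δ, Y₁, hcΔ, le_max_left _ _, fun Y hY d H hd hH hdle => ?_⟩
  have hd1 : (1 : ℝ) ≤ d := by exact_mod_cast hd
  have hd0 : (0 : ℝ) ≤ d := by positivity
  have hH1 : (1 : ℝ) ≤ H := by exact_mod_cast hH
  have hL : 0 ≤ Real.log H := Real.log_nonneg hH1
  have hcC : 0 ≤ c * C := by positivity
  -- monotonicity in the exponents (base `d ≥ 1`)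
  have hda : (d : ℝ) ^ a ≤ (d : ℝ) ^ A := Real.rpow_le_rpow_of_exponent_le hd1 (le_max_left _ _)
  have hdb : (d : ℝ) ^ b ≤ (d : ℝ) ^ B := Real.rpow_le_rpow_of_exponent_le hd1 (le_max_left _ _)
  -- `d ≤ (cΔ)^t` in the exponents `A`, `B`
  have hpow : ∀ E : ℝ, 0 ≤ E → (d : ℝ) ^ E ≤ (c * Δ) ^ ((t : ℝ) * E) := fun E hE => by
    calc (d : ℝ) ^ E ≤ ((c * Δ) ^ t) ^ E := Real.rpow_le_rpow hd0 hdle hE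
      _ = (c * Δ) ^ ((t : ℝ) * E) := by
        rw [← Real.rpow_natCast, ← Real.rpow_mul hcΔpos.le]
  have hdA : (d : ℝ) ^ A ≤ (c * Δ) ^ ((t : ℝ) * A) := hpow A hA0
  have hdB : (d : ℝ) ^ B ≤ (c * Δ) ^ ((t : ℝ) * B) := hpow B hB0
  -- first term: `cC d^A ≤ Δ`
  have hI : c * C * (d : ℝ) ^ A ≤ Δ := by
    calc c * C * (d : ℝ) ^ A ≤ c * C * (c * Δ) ^ ((t : ℝ) * A) :=
          mul_le_mul_of_nonneg_left hdA hcC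
      _ = M * Δ ^ ((t : ℝ) * A) := by
          rw [Real.mul_rpow hcpos.le hΔpos.le, hM]; ring
      _ ≤ Δ ^ e * Δ ^ ((t : ℝ) * A) :=
          mul_le_mul_of_nonneg_right hMΔ (Real.rpow_nonneg hΔpos.le _)
      _ = Δ := by
          rw [← Real.rpow_add hΔpos, he, sub_add_cancel, Real.rpow_one]
  have hI' : c * C * (d : ℝ) ^ A * Real.log H ≤ Δ * Real.log H :=
    mul_le_mul_of_nonneg_right hI hL
  -- second term: `cC d^B < Y₁ ≤ Y ≤ d Y`
  have hY0 : 0 ≤ Y := le_trans hΔpos.le (le_trans (le_max_left _ _) hY)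
  have hII : c * C * (d : ℝ) ^ B < (d : ℝ) * Y := by
    calc c * C * (d : ℝ) ^ B ≤ c * C * (c * Δ) ^ ((t : ℝ) * B) :=
          mul_le_mul_of_nonneg_left hdB hcC
      _ < c * C * (c * Δ) ^ ((t : ℝ) * B) + 1 := lt_add_one _
      _ ≤ Y₁ := le_max_right _ _
      _ ≤ Y := hY
      _ ≤ (d : ℝ) * Y := le_mul_of_one_le_left hY0 hd1
  -- assemble
  have h1 : c * C * ((d : ℝ) ^ a * Real.log H) ≤ c * C * ((d : ℝ) ^ A * Real.log H) :=
    mul_le_mul_of_nonneg_left (mul_le_mul_of_nonneg_right hda hL) hcC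
  have h2 : c * C * (d : ℝ) ^ b ≤ c * C * (d : ℝ) ^ B := mul_le_mul_of_nonneg_left hdb hcC
  have hexp : c * (C * ((d : ℝ) ^ a * Real.log H + (d : ℝ) ^ b)) =
      c * C * ((d : ℝ) ^ a * Real.log H) + c * C * (d : ℝ) ^ b := by ring
  rw [hexp]
  linarith [h1, h2, hI', hII]

/-- The integer polynomials of degree `≤ D` and naive height `≤ H` form a finite set (they are
determined by their `D + 1` coefficients in `[-H, H]`). [folklore] -/
theorem ApproximationRaceEv.finite_polys (D H : ℕ) :
    {P : Polynomial ℤ | P.natDegree ≤ D ∧ ∀ k, |P.coeff k| ≤ (H : ℤ)}.Finite := by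
  refine Set.Finite.of_finite_image (f := fun P : Polynomial ℤ => fun k : Fin (D + 1) => P.coeff k)
    ?_ ?_
  · refine (Set.Finite.pi (fun _ : Fin (D + 1) => Set.finite_Icc (-(H : ℤ)) H)).subset ?_
    rintro f ⟨P, hP, rfl⟩
    simp only [Set.mem_pi, Set.mem_univ, Set.mem_Icc, forall_const]
    exact fun k => abs_le.mp (hP.2 k)
  · rintro P hP Q hQ hPQ
    ext k
    by_cases hk : k ≤ D
    · exact congr_fun hPQ ⟨k, Nat.lt_succ_of_le hk⟩
    · rw [Polynomial.coeff_eq_zero_of_natDegree_lt (by have := hP.1; omega),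
        Polynomial.coeff_eq_zero_of_natDegree_lt (by have := hQ.1; omega)]

/-- NAIVE NORTHCOTT: the complex roots of the non-zero integer polynomials of degree `≤ D` and
naive height `≤ H` form a finite set. [folklore] -/
theorem ApproximationRaceEv.finite_roots (D H : ℕ) :
    {z : ℂ | ∃ P : Polynomial ℤ, P ≠ 0 ∧ P.natDegree ≤ D ∧ (∀ k, |P.coeff k| ≤ (H : ℤ)) ∧
      Polynomial.aeval z P = 0}.Finite := by
  refine ((ApproximationRaceEv.finite_polys D H).biUnion
    (fun P _ => Polynomial.rootSet_finite P ℂ)).subset ?_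
  rintro z ⟨P, hP0, hdeg, hH, hz⟩
  simp only [Set.mem_iUnion, Set.mem_setOf_eq, exists_prop]
  exact ⟨P, ⟨hdeg, hH⟩, Polynomial.mem_rootSet.mpr ⟨hP0, hz⟩⟩

/-- A root of a non-zero integer polynomial is algebraic over `ℚ`. [folklore] -/
theorem ApproximationRaceEv.isAlgebraic_of_root {P : Polynomial ℤ} {z : ℂ} (hP : P ≠ 0)
    (hz : Polynomial.aeval z P = 0) : IsAlgebraic ℚ z := by
  refine ⟨P.map (algebraMap ℤ ℚ), ?_, ?_⟩
  · exact (Polynomial.map_ne_zero_iff (algebraMap ℤ ℚ).injective_int).mpr hP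
  · rw [Polynomial.aeval_map_algebraMap, hz]

/-! ## The item -/

/-- **`ApproximationRaceEv`** (route `DiophantineDichotomy`, support item stmt-Schanuel-14973, the
glue of `closes`): Philippon's approximation property (`ApproximationProperty`) and the
EVENTUAL-in-the-height simultaneous approximation measure with degree exponent `a < 1/(n−1)` at
free Khovanskii points (`KhovanskiiApproxTypeEv`) imply Schanuel's conjecture at free Khovanskii
points (`KhovanskiiSchanuel`): `n = 0` trivial, `n = 1` Hermite–Lindemann, `n ≥ 2` race
compactness — the race `ApproximationRaceEv.race` at ONE fixed scale `Δ` with `Y → ∞`, the naive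
Northcott finiteness `ApproximationRaceEv.finite_roots` forcing the heights of the approximants past
every threshold `H₀(d)`, `d ≤ (cΔ)^t`. [folklore] -/
theorem approximationRaceEv_proof : ApproximationRaceEv := by
  intro hAP hEv n s hs hg
  rcases Nat.lt_or_ge n 2 with hn | hn
  · interval_cases n
    · simp
    · -- `n = 1`: Hermite–Lindemann
      rw [Nat.cast_one]
      have hs0 : s 0 ≠ 0 := hs.ne_zero 0
      by_cases halg : IsAlgebraic ℚ (s 0)
      · exact ApproximationRace.one_le_trdeg_of_mem
          (IntermediateField.subset_adjoin ℚ _ (Or.inr ⟨0, rfl⟩))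
          (Literature.NumberTheory.Transcendental.transcendental_exp_holds halg hs0)
      · exact ApproximationRace.one_le_trdeg_of_mem
          (IntermediateField.subset_adjoin ℚ _ (Or.inl ⟨0, rfl⟩)) halg
  · -- `n ≥ 2`: race compactness
    by_contra hlt
    rw [not_le] at hlt
    have hle := ApproximationRace.le_pred_of_lt_natCast (by omega) hlt
    -- transport `trdeg ≤ n - 1` along `range (Sum.elim s (exp ∘ s)) = range s ∪ range (exp ∘ s)`
    -- (stated for a general set: the `ℚ`-algebra instance carries a proof depending on the set)
    have key : ∀ S : Set ℂ, S = Set.range s ∪ Set.range (Complex.exp ∘ s) →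
        Algebra.trdeg ℚ ↥(IntermediateField.adjoin ℚ S) ≤ ((n - 1 : ℕ) : Cardinal) := by
      rintro S rfl
      exact hle
    set θ : Fin n ⊕ Fin n → ℂ := Sum.elim s (Complex.exp ∘ s) with hθ
    obtain ⟨c, hc1, hAP'⟩ := hAP (Fin n ⊕ Fin n) θ (n - 1) (by omega) (key _ (Set.Sum.elim_range _ _))
    obtain ⟨a, b, C, ha, hC, hEv'⟩ := hEv n s hn hs hg
    choose H₀ hH₀ using hEv'
    have ha' : a < 1 / ((n - 1 : ℕ) : ℝ) := by
      rw [Nat.cast_sub (by omega), Nat.cast_one]; exact ha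
    have hcpos : (0 : ℝ) < c := lt_of_lt_of_le one_pos hc1
    -- the race at a fixed scale `Δ`
    obtain ⟨Δ, Y₁, hcΔ, hΔY₁, hrace⟩ :=
      ApproximationRaceEv.race (t := n - 1) (by omega) hc1 hC ha'
    have hΔpos : 0 < Δ := lt_of_lt_of_le hcpos hcΔ
    -- the degree budget and the height threshold at this scale
    set D₀ : ℕ := ⌊(c * Δ) ^ (n - 1)⌋₊ with hD₀
    set Hs : ℕ := (Finset.range (D₀ + 1)).sup H₀ with hHs
    -- the finite set of low points
    set R : Set ℂ := {z : ℂ | ∃ P : Polynomial ℤ, P ≠ 0 ∧ P.natDegree ≤ D₀ ∧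
      (∀ k, |P.coeff k| ≤ (Hs : ℤ)) ∧ Polynomial.aeval z P = 0} with hR
    set F : Set (Fin n ⊕ Fin n → ℂ) := Set.pi Set.univ (fun _ => R) with hF
    have hFfin : F.Finite := Set.Finite.pi (fun _ => ApproximationRaceEv.finite_roots D₀ Hs)
    -- `θ ∉ F`: `θ` has a transcendental coordinate
    have hθF : θ ∉ F := by
      have hs0 : s ⟨0, by omega⟩ ≠ 0 := hs.ne_zero ⟨0, by omega⟩
      have htr : ∃ i, Transcendental ℚ (θ i) := by
        by_cases halg : IsAlgebraic ℚ (s ⟨0, by omega⟩)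
        · exact ⟨Sum.inr ⟨0, by omega⟩,
            Literature.NumberTheory.Transcendental.transcendental_exp_holds halg hs0⟩
        · exact ⟨Sum.inl ⟨0, by omega⟩, halg⟩
      obtain ⟨i, hi⟩ := htr
      intro hmem
      obtain ⟨P, hP0, -, -, hz⟩ := hmem i (Set.mem_univ i)
      exact hi (ApproximationRaceEv.isAlgebraic_of_root hP0 hz)
    -- a ball around `θ` missing `F`
    obtain ⟨ε, hε, hball⟩ := Metric.isOpen_iff.mp hFfin.isClosed.isOpen_compl θ hθF
    -- a large second scale `Y`
    have hevY : ∀ᶠ Y in Filter.atTop, Y₁ ≤ Y ∧ Real.exp (-(Y / c)) < ε := by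
      refine (Filter.eventually_ge_atTop Y₁).and ?_
      have h1 : Filter.Tendsto (fun Y : ℝ => -(Y / c)) Filter.atTop Filter.atBot :=
        Filter.tendsto_neg_atTop_atBot.comp (Filter.tendsto_id.atTop_div_const hcpos)
      exact (Real.tendsto_exp_atBot.comp h1).eventually (gt_mem_nhds hε)
    obtain ⟨Y, hY₁Y, hYε⟩ := hevY.exists
    have hΔY : Δ ≤ Y := hΔY₁.trans hY₁Y
    -- the approximant at scale `(Δ, Y)`
    obtain ⟨γ, d, H, hfin, hpoly, hd, -, hdist⟩ := hAP' Δ Y hcΔ hΔY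
    obtain ⟨P, hP0, hPdeg, hPH, hPz⟩ := hpoly (Sum.inl ⟨0, by omega⟩)
    have h1d : 1 ≤ d := ApproximationRace.one_le_of_root hP0 hPdeg hPz
    have h1H : 1 ≤ H := ApproximationRace.one_le_height hP0 hPH
    have hd1 : (1 : ℝ) ≤ d := by exact_mod_cast h1d
    have hH1 : (1 : ℝ) ≤ H := by exact_mod_cast h1H
    have hL : 0 ≤ Real.log H := Real.log_nonneg hH1
    have hdD₀ : d ≤ D₀ := Nat.le_floor hd
    -- `‖γ - θ‖ < ε`, so `γ ∉ F`
    have hγθ : ‖γ - θ‖ < ε := by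
      refine lt_of_le_of_lt (hdist.trans (Real.exp_le_exp.mpr ?_)) hYε
      rw [neg_le_neg_iff, div_le_div_iff_of_pos_right hcpos]
      have hY0 : 0 ≤ Y := hΔpos.le.trans hΔY
      nlinarith [mul_nonneg hL hΔpos.le]
    have hγF : γ ∉ F := by
      refine hball ?_
      rw [Metric.mem_ball, dist_eq_norm]
      exact hγθ
    -- hence the height is past the threshold
    have hHsH : Hs < H := by
      by_contra hle'
      rw [not_lt] at hle'
      refine hγF fun i _ => ?_
      obtain ⟨Q, hQ0, hQdeg, hQH, hQz⟩ := hpoly i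
      refine ⟨Q, hQ0, hQdeg.trans hdD₀, fun k => (hQH k).trans ?_, hQz⟩
      exact_mod_cast hle'
    have hH₀H : H₀ d ≤ H := by
      have : H₀ d ≤ Hs := Finset.le_sup (f := H₀) (Finset.mem_range.mpr (Nat.lt_succ_of_le hdD₀))
      omega
    -- the eventual measure applies
    have hlow := hH₀ d H γ hH₀H hfin hpoly
    have hsand := Real.exp_le_exp.mp (hlow.trans hdist)
    have hineq : Real.log H * Δ + d * Y ≤ c * (C * ((d : ℝ) ^ a * Real.log H + (d : ℝ) ^ b)) := by
      have := neg_le_neg hsand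
      rw [neg_neg, neg_neg, div_le_iff₀ hcpos] at this
      linarith
    exact absurd hineq (not_le.mpr (hrace Y hY₁Y d H h1d h1H hd))

end Summit.Schanuel.Schanuel.Theorems
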